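import Summits.Schanuel.Schanuel.Theorems.RootDecomp1KResidueDescent01

/-!
# RootDecomp1KResidueDescent — lens 1, generation 68, NODE 28 «DESCENT INTO THE SECTOR — BOTH RESIDUE EXHIBITS OF RECORD DECIDED» (×0-AS-RECORD, PRICE L3059; ERRATUM E5; CLAIM L3057, NODE L3068, VERDICT L3071): `thinFibreAt_rho1` / `levelFinite_rho1` (no level point at ANY N ≥ 4 — bi-pure gcd descent + the digit mod 32; family `quartC c = Y⁴ + x·Y − c·x²`, c an odd prime ≢ 1 mod 32) and `thinFibreAt_rho2` / `levelFinite_rho2` (descent onto the x-LINEAR auxiliaries `17Y⁴ + Y³ − x`, `Y⁴ + Y³ − 17³·x`, decided by the TREE's `levelFinite_xLinear` ← node 2's `thinFibreAt_xLinear`; family `bisqC c = (Y² − c·x)² − x·Y`), and the typed NOT-BI-PURE nominees `residue_rho1'` / `residue_rho2'` (ρ1′ = Y⁴ + Y³ + x·Y + x − 17x², ρ2′ = (Y² − 17x)² − x·Y − x) — continuation (RootDecomp1KResidueDescent02): §4  THE LEVEL ABSCISSA READ TWO LEVELS DEEP: `N! = 2m`, `2^m ∣ p_N − 1`, `p_N`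 odd and positive · §5  ρ1 DECIDED: `R₁(c) = Y⁴ + x·Y − c·x²` has NO LEVEL POINT at any level `N ≥ 4` · §6  ρ2 TRANSPORTED INTO THE x-LINEAR CLASS: `R₂(c) = (Y² − c·x)² − x·Y` ⟶ `c·Y⁴ + Y³ − x`, `Y⁴ + Y³ − c³·x` — 17 declarations `shape4` … `bound_one`

(lens-1 g68 NODE 28 «DESCENT INTO THE SECTOR» L3068: HOME kernel K = HOME/decomp-schanuel-lens-1/g68/lean/ResidueDescent.lean sha256 7ab17922…, 1232 l, 74 decls (70 theorems + 4 defs), ONE namespace `Summit.Schanuel.Schanuel.Theorems.RootDecomp1KResidueDescent`, imports the tree port …RootDecomp1KSectorTheorem10 ONLY (node 27's THEOREM ×1 port; `rho1` / `rho2` / `Residue` / `SectorCond` / `exists_fourth_root_seventeen` / `exists_sqrt_seventeen` / `levelFinite_xLinear` / `levelFinite_of_thinFibreAt_zero` BY TREE NAME); no private / instance / set_option / notation / sorry / new axiom / binder, `decide` only on ZMod 32 / small literals; lens farm rc 0 · 0 errors · 0 sorries · 74 dupNamespace, `--axioms` standard on 17 names, Probe g68/out/Probe.lean 9038b768… rc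 0, memo g68/NODE-g68.md 3833b29f…; CLAIM L3057 (ASK-FIRST under K-R58 (iii)); crit g12 PRICE L3059: ×0-AS-RECORD («the levers are bi-pure DESCENT ∪ LOCAL SIEVING mod 32 (ρ1) ∪ the EDGE ENGINE BY NAME (ρ2)»), correction e28-pre-1 (the w = 289 auxiliary `Y⁴ + Y³ − 17³·x`, ADOPTED by the lens), CHECKLIST K-g68 (D1)–(D5) + (S), ERRATUM E5 PRE-ANNOUNCED (exhibits of record must be typed-Residue AND not toolkit-decided, in particular NOT bi-pure; rho1 / rho2 leave the exhibit list and join the unconditional part; exhibits := ∅ until ρ1′ / ρ2′ are certified); writer g35 pre-check NOTE 1 L3060; census LIVENESS-v38 (key bipure: rho1 / rho2 bi-pure, ρ1′ / ρ2′ not; key edge on the nominees: ρ1 / ρ2 by the recipe); crit g12 VERDICT L3071 (04:51Z): ×0-AS-RECORD BOOKED (CHECKLIST K-g68 (D1)–(D4) + (S) met on the critic's own farm runs; (D5) declined-as-typed, families instead), TALLY UNCHANGED lens-1 ×22 + THEOREM ×24, ERRATUM E5 FIXED (PRICE L3059 (E5-a)–(E5-d) verbatim; instantiation: toolkit ∪=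 bi-pure descent; rho1 / rho2 leave the exhibit list and join the unconditional part; exhibits of record := ρ1′ / ρ2′ effective at port landing; ledger and non-dominant territory unchanged), W-28-1 (typed (T♭) welcome, ×0), PORT GO → census-1 (this port; PORT IDENTITY 28 owed by the seated critic). Port by census-1 gen 25 as `RootDecomp1KResidueDescent01–04` (files ≤ 400 lines; `--supports stmt-Schanuel-33364`, the item stays OPEN; ×0 record port, no credit anywhere; E5: UNCONDITIONAL PART ∪= these names): 01 = K l.1–378 of the prepped source (opens §0 / §1 / §2 / §3) — 20 decls `quartC`, `bisqC`, `rho1_eq_quartC`, …, `int_eq4`; 02 = K l.379–693 of the prepped source (opens §4 / §5 / §6) — 17 decls `shape4`, `level_exponent`, `two_pow_dvd_psNumer_sub_one`, …, `bound_one`; 03 = K l.694–941 of the prepped source (opens # The x-linear input BY TREE NAME: `RootDecomp1KXLinear.thinFibreAt_xLinear` (XLinear05) at quality `0` / # (D2) THE STRATUM-ρ2 EXHIBIT OF RECORD `rho2 = (Y² − 17x)² − x·Y`, DECIDED / # Sanity instance (PRICE L3059): the level-`m = 8` integer point of the ρ2 equation and its descent parameter / §7 / # ρ1′ = `Y⁴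 + Y³ + x·Y + x − 17·x²`) — 26 decls `bound_two`, `three_le_abs`, `aeval_aux₁`, …, `rho1'_axisY_two_monomials`; 04 = K l.942–1253 of the prepped source (opens # ρ2′ = `(Y² − 17x)² − x·Y − x`) — 11 decls `residue_rho1'`, `sectorCond_rho1'`, `rho2'`, …, `nominees`. 22 one-line docstrings synthesised for undocumented helper declarations (statements quoted); everything else = K VERBATIM (statements, names, proofs, K's module docstring kept in part 01 below this provenance block).)
-/

noncomputable section

namespace Summit.Schanuel.Schanuel.Theorems.RootDecomp1KResidueDescent

open Polynomial LiouvilleNumber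
open scoped Nat
open Summit.Schanuel.Schanuel.Theorems.RootDecomp1KTwoBaseCell (psNumer partialSum_eq_psNumer_div coprime_psNumer)
open Summit.Schanuel.Schanuel.Theorems.RootDecomp1KDegreeLadder
open Summit.Schanuel.Schanuel.Theorems.RootDecomp1KXLinear (xLinP bev_xLinP thinFibreAt_xLinear)
open Summit.Schanuel.Schanuel.Theorems.RootDecomp1KXTop
open Summit.Schanuel.Schanuel.Theorems.RootDecomp1KLevelFinite
open Summit.Schanuel.Schanuel.Theorems.RootDecomp1KOddEmpty (levelFinite_of_no_level)
open Summit.Schanuel.Schanuel.Theorems.RootDecomp1KHeightGrading (BddLevelEmpty bddLevelEmpty_iff_levelFinite)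
open Summit.Schanuel.Schanuel.Theorems.RootDecomp1KDigitPincer (odd_psNumer_two two_pow_dvd_of_dvd_mul_odd)
open Summit.Schanuel.Schanuel.Theorems.RootDecomp1KTrinomialDescent (partialSum_two_eq_int_div)
open Summit.Schanuel.Schanuel.Theorems.RootDecomp1KRunge (psNumer_pos_runge)
open Summit.Schanuel.Schanuel.Theorems.RootDecomp1KLocalExponent (rootMult)
open Summit.Schanuel.Schanuel.Theorems.RootDecomp1KSectorTheorem (Residue SectorCond EdgeGood TopWeight RootGood layerPoly supp
  layerPoly_eq_sum mem_supp_of aeval_eq_eval_map rho1 rho2 rho1_zero rho1_one rho1_two rho2_zero rho2_one rho2_two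
  aeval_intCast_padicInt exists_padicInt_root exists_fourth_root_seventeen exists_sqrt_seventeen
  levelFinite_of_thinFibreAt_zero levelFinite_xLinear)

/-- (P2)+(P3) **level shape**: for `γ`, `p` odd and `m ≥ 1`, an integer solution of the cleared equation has
`den r = 2^m`, `num r` odd, and `W := num r` solves the REDUCED equation `W⁴ + α·p·W² + β·p·2^m·W + γ·p² = 0`
(the far edge ties: `W = 2^m·r` is an odd integer). -/
theorem shape4 {α β γ p : ℤ} (hγ : Odd γ) (hp : Odd p) {m : ℕ} (hm : 1 ≤ m) {r : ℚ}
    (h : r.num ^ 4 * 2 ^ (4 * m) + α * p * r.num ^ 2 * (r.den : ℤ) ^ 2 * 2 ^ (2 * m)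
        + β * p * r.num * (r.den : ℤ) ^ 3 * 2 ^ (2 * m) + γ * p ^ 2 * (r.den : ℤ) ^ 4 = 0) :
    (r.den : ℤ) = 2 ^ m ∧ Odd r.num ∧
      r.num ^ 4 + α * p * r.num ^ 2 + β * p * 2 ^ m * r.num + γ * p ^ 2 = 0 := by
  set a : ℤ := r.num with ha
  set d : ℕ := r.den with hd
  -- (P2) d ∣ a⁴·2^{4m} and d ⊥ a ⟹ d = 2^e
  have hdvd : (d : ℤ) ∣ a ^ 4 * 2 ^ (4 * m) := by
    refine ⟨-(α * p * a ^ 2 * (d : ℤ) * 2 ^ (2 * m) + β * p * a * (d : ℤ) ^ 2 * 2 ^ (2 * m)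
      + γ * p ^ 2 * (d : ℤ) ^ 3), ?_⟩
    linear_combination h
  have hred : Nat.Coprime d a.natAbs := Nat.coprime_comm.mp r.reduced
  have hcop : IsCoprime (d : ℤ) (a ^ 4) := by
    refine IsCoprime.pow_right ?_
    rw [Int.isCoprime_iff_nat_coprime]
    simpa using hred
  have hd2 : (d : ℤ) ∣ 2 ^ (4 * m) := hcop.dvd_of_dvd_mul_left hdvd
  have hd2' : d ∣ 2 ^ (4 * m) := by exact_mod_cast hd2
  obtain ⟨e, -, hde⟩ := (Nat.dvd_prime_pow Nat.prime_two).1 hd2'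
  have hdeZ : (d : ℤ) = 2 ^ e := by exact_mod_cast hde
  rw [hdeZ] at h
  -- `a` is odd as soon as `e ≥ 1`
  have hodd_of : 1 ≤ e → Odd a := fun he => by
    refine Int.not_even_iff_odd.mp fun hae => ?_
    have h2d : 2 ∣ d := by
      rw [hde]; exact dvd_pow_self 2 (by omega)
    have h2a : 2 ∣ a.natAbs := by
      have := Int.natAbs_dvd_natAbs.mpr (even_iff_two_dvd.mp hae)
      simpa using this
    exact Nat.not_coprime_of_dvd_of_dvd one_lt_two h2d h2a hred
  -- (P3) e = m
  have hem : e = m := by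
    rcases Nat.lt_trichotomy e m with hlt | heq | hgt
    · -- e < m: γ·p² is even — absurd
      exfalso
      obtain ⟨t, rfl⟩ : ∃ t, m = e + 1 + t := ⟨m - e - 1, by omega⟩
      have key : ((2 : ℤ) ^ e) ^ 4 * (γ * p ^ 2 + 2 * (a ^ 4 * 2 ^ 3 * (2 ^ t) ^ 4
          + α * p * a ^ 2 * 2 * (2 ^ t) ^ 2 + β * p * a * 2 ^ e * 2 * (2 ^ t) ^ 2)) = 0 := by
        have e4 : (2 : ℤ) ^ (4 * (e + 1 + t)) = (2 ^ e) ^ 4 * 2 ^ 4 * (2 ^ t) ^ 4 := by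
          rw [show 4 * (e + 1 + t) = e * 4 + 4 + t * 4 by ring, pow_add, pow_add, pow_mul, pow_mul]
        have e2 : (2 : ℤ) ^ (2 * (e + 1 + t)) = (2 ^ e) ^ 2 * 2 ^ 2 * (2 ^ t) ^ 2 := by
          rw [show 2 * (e + 1 + t) = e * 2 + 2 + t * 2 by ring, pow_add, pow_add, pow_mul, pow_mul]
        rw [e4, e2] at h
        linear_combination h
      have h2e : ((2 : ℤ) ^ e) ^ 4 ≠ 0 := by positivity
      have hsum := (mul_eq_zero.mp key).resolve_left h2e
      have heven : Even (γ * p ^ 2) := ⟨-(a ^ 4 * 2 ^ 3 * (2 ^ t) ^ 4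
          + α * p * a ^ 2 * 2 * (2 ^ t) ^ 2 + β * p * a * 2 ^ e * 2 * (2 ^ t) ^ 2), by linear_combination hsum⟩
      exact Int.not_even_iff_odd.mpr (hγ.mul (hp.pow)) heven
    · exact heq
    · -- e > m: a⁴ is even — absurd (a is odd since e ≥ 1)
      exfalso
      obtain ⟨t, rfl⟩ : ∃ t, e = m + 1 + t := ⟨e - m - 1, by omega⟩
      have key : ((2 : ℤ) ^ m) ^ 4 * (a ^ 4 + 2 * (α * p * a ^ 2 * 2 * (2 ^ t) ^ 2
          + β * p * a * 2 ^ m * 2 ^ 2 * (2 ^ t) ^ 3 + γ * p ^ 2 * 2 ^ 3 * (2 ^ t) ^ 4)) = 0 := by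
        have e4 : (2 : ℤ) ^ (4 * m) = (2 ^ m) ^ 4 := by rw [pow_mul']
        have e2 : (2 : ℤ) ^ (2 * m) = (2 ^ m) ^ 2 := by rw [pow_mul']
        have e1 : (2 : ℤ) ^ (m + 1 + t) = 2 ^ m * 2 * 2 ^ t := by rw [pow_add, pow_add, pow_one]
        rw [e4, e2, e1] at h
        linear_combination h
      have h2m : ((2 : ℤ) ^ m) ^ 4 ≠ 0 := by positivity
      have hsum := (mul_eq_zero.mp key).resolve_left h2m
      have heven : Even (a ^ 4) := ⟨-(α * p * a ^ 2 * 2 * (2 ^ t) ^ 2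
          + β * p * a * 2 ^ m * 2 ^ 2 * (2 ^ t) ^ 3 + γ * p ^ 2 * 2 ^ 3 * (2 ^ t) ^ 4), by linear_combination hsum⟩
      exact Int.not_even_iff_odd.mpr ((hodd_of (by omega)).pow) heven
  subst hem
  refine ⟨hdeZ, hodd_of hm, ?_⟩
  have key : ((2 : ℤ) ^ e) ^ 4 * (a ^ 4 + α * p * a ^ 2 + β * p * 2 ^ e * a + γ * p ^ 2) = 0 := by
    have e4 : (2 : ℤ) ^ (4 * e) = (2 ^ e) ^ 4 := by rw [pow_mul']
    have e2 : (2 : ℤ) ^ (2 * e) = (2 ^ e) ^ 2 := by rw [pow_mul']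
    rw [e4, e2] at h
    linear_combination h
  have h2e : ((2 : ℤ) ^ e) ^ 4 ≠ 0 := by positivity
  exact (mul_eq_zero.mp key).resolve_left h2e

/-! ## §4  THE LEVEL ABSCISSA READ TWO LEVELS DEEP: `N! = 2m`, `2^m ∣ p_N − 1`, `p_N` odd and positive -/

/-- the exponent bookkeeping at a level `N ≥ 2`: `N! = 2m` with `1 ≤ m ≤ N! − (N−1)!`; `N ≥ 4 ⟹ m ≥ 5 ∧ 2 ∣ m`. -/
theorem level_exponent {N : ℕ} (hN : 2 ≤ N) :
    ∃ m : ℕ, N ! = 2 * m ∧ 1 ≤ m ∧ m ≤ (N !) - (N - 1)! ∧ (4 ≤ N → 12 ≤ m ∧ 2 ∣ m) := by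
  obtain ⟨m, hm⟩ := Nat.dvd_factorial two_pos hN
  obtain ⟨n, rfl⟩ : ∃ n, N = n + 1 := ⟨N - 1, by omega⟩
  have hfac : (n + 1)! = (n + 1) * n ! := Nat.factorial_succ n
  have hF : 1 ≤ n ! := Nat.one_le_iff_ne_zero.mpr (Nat.factorial_ne_zero n)
  refine ⟨m, hm, ?_, ?_, fun h4 => ⟨?_, ?_⟩⟩
  · have : 1 ≤ (n + 1)! := Nat.one_le_iff_ne_zero.mpr (Nat.factorial_ne_zero _)
    omega
  · simp only [Nat.add_sub_cancel]
    have h1 : (n + 1) * n ! ≤ 2 * (n * n !) := by nlinarith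
    rw [← hfac, hm] at h1
    have h2 : n ! ≤ (n + 1)! := Nat.factorial_le (by omega)
    rw [hm] at h2 ⊢
    have h3 : (n + 1)! = n * n ! + n ! := by rw [hfac]; ring
    omega
  · have h24 : (4)! ≤ (n + 1)! := Nat.factorial_le h4
    have : (4)! = 24 := rfl
    omega
  · have h4d : 4 ∣ (n + 1)! := Nat.dvd_factorial (by norm_num) h4
    rw [hm] at h4d
    obtain ⟨k, hk⟩ := h4d
    exact ⟨k, by omega⟩

/-- the DIGIT: `2^{N! − (N−1)!} ∣ p_N − 1` (`N ≥ 1`; tree `psNumer_succ`). -/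
theorem two_pow_dvd_psNumer_sub_one {N : ℕ} (hN : 1 ≤ N) :
    (2 : ℤ) ^ ((N !) - (N - 1)!) ∣ (psNumer 2 N : ℤ) - 1 := by
  obtain ⟨n, rfl⟩ : ∃ n, N = n + 1 := ⟨N - 1, by omega⟩
  simp only [Nat.add_sub_cancel]
  refine ⟨(psNumer 2 n : ℤ), ?_⟩
  have e := psNumer_succ 2 n
  zify at e
  linear_combination e

/-- `0 < p_N` in `ℤ`. -/
theorem psNumer_two_pos_int (N : ℕ) : (0 : ℤ) < (psNumer 2 N : ℤ) := by
  exact_mod_cast psNumer_pos_runge N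

/-- `p_N < 2·2^{N!}` in `ℤ` (tree `psNumer_lt`). -/
theorem psNumer_two_lt_int (N : ℕ) : (psNumer 2 N : ℤ) < 2 * 2 ^ N ! := by
  exact_mod_cast psNumer_lt N

/-! ## §5  ρ1 DECIDED: `R₁(c) = Y⁴ + x·Y − c·x²` has NO LEVEL POINT at any level `N ≥ 4`
(`c` an odd prime, `c ≢ 1 (mod 32)`; `c = 17` is the stratum-ρ1 exhibit `rho1` of record) -/

/-- **no level point of `R₁(c)` at `N ≥ 4`** (descent + the digit; hypothesis-free). -/
theorem no_level_quartC {c : ℤ} (hc : Prime c) (hodd : Odd c) (h32 : ¬ (32 : ℤ) ∣ c - 1) {N : ℕ}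
    (hN : 4 ≤ N) (r : ℚ) : bev (xPolyP 2 (quartC c)) (partialSum 2 N) r ≠ 0 := by
  intro h
  obtain ⟨m, hNm, hm1, hmle, h4⟩ := level_exponent (show 2 ≤ N by omega)
  obtain ⟨hm12, -⟩ := h4 hN
  set p : ℤ := (psNumer 2 N : ℤ) with hpdef
  have hp_odd : Odd p := odd_psNumer_two (by omega)
  have hp0 : 0 < p := psNumer_two_pos_int N
  have hp1 : (2 : ℤ) ^ m ∣ p - 1 := (pow_dvd_pow 2 hmle).trans (two_pow_dvd_psNumer_sub_one (by omega))
  have hx : partialSum 2 N = (p : ℝ) / 2 ^ (2 * m) := by rw [partialSum_two_eq_int_div, hNm]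
  rw [bev_quartC, hx] at h
  have hint := int_eq4 0 1 (-c) p m r (by push_cast; linear_combination h)
  obtain ⟨-, -, hred⟩ := shape4 (by simpa using hodd.neg) hp_odd hm1 hint
  exact core_quart hc h32 (by omega) hp0 hp1 (W := r.num) (by linear_combination hred)

/-- `LevelSet (R₁(c)) C ⊆ {N < 4}`. -/
theorem levelSet_quartC_subset {c : ℤ} (hc : Prime c) (hodd : Odd c) (h32 : ¬ (32 : ℤ) ∣ c - 1) (C : ℝ) :
    LevelSet (xPolyP 2 (quartC c)) C ⊆ {N | N < 4} := by
  rintro N ⟨r, -, hP, -⟩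
  by_contra hN
  exact no_level_quartC hc hodd h32 (by simpa using hN) r hP

/-- **`LevelFinite (R₁(c))`** — hypothesis-free. -/
theorem levelFinite_quartC {c : ℤ} (hc : Prime c) (hodd : Odd c) (h32 : ¬ (32 : ℤ) ∣ c - 1) :
    LevelFinite (xPolyP 2 (quartC c)) := fun C =>
  (Set.finite_lt_nat 4).subset (levelSet_quartC_subset hc hodd h32 C)

/-- **`ThinFibreAt m₀ (R₁(c))` at EVERY quality `m₀`** — hypothesis-free. -/
theorem thinFibreAt_quartC {c : ℤ} (hc : Prime c) (hodd : Odd c) (h32 : ¬ (32 : ℤ) ∣ c - 1) (m₀ : ℕ) :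
    ThinFibreAt m₀ (xPolyP 2 (quartC c)) :=
  thinFibreAt_of_levelFinite (levelFinite_quartC hc hodd h32) m₀

/-- **THE STRATUM-ρ1 EXHIBIT OF RECORD HAS NO LEVEL POINT AT ANY LEVEL `N ≥ 4`.** -/
theorem no_level_rho1 {N : ℕ} (hN : 4 ≤ N) (r : ℚ) : bev (xPolyP 2 rho1) (partialSum 2 N) r ≠ 0 := by
  rw [rho1_eq_quartC]; exact no_level_quartC prime_seventeen (by decide) not_dvd_sixteen hN r

/-- `(C : ℝ) : LevelSet (xPolyP 2 rho1) C ⊆ {N | N < 4}`. -/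
theorem levelSet_rho1_subset (C : ℝ) : LevelSet (xPolyP 2 rho1) C ⊆ {N | N < 4} := by
  rw [rho1_eq_quartC]; exact levelSet_quartC_subset prime_seventeen (by decide) not_dvd_sixteen C

/-- **`LevelFinite rho1`** (hypothesis-free). -/
theorem levelFinite_rho1 : LevelFinite (xPolyP 2 rho1) := by
  rw [rho1_eq_quartC]; exact levelFinite_quartC prime_seventeen (by decide) not_dvd_sixteen

/-- **`BddLevelEmpty rho1`** (the B-side currency). -/
theorem bddLevelEmpty_rho1 : BddLevelEmpty (xPolyP 2 rho1) := (bddLevelEmpty_iff_levelFinite _).mpr levelFinite_rho1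

/-- **`ThinFibreAt m₀ rho1` for EVERY `m₀`** — in particular at the residue qualities `m₀ ≤ 2` of node 27's
`residue_rho1` (hypothesis-free; no Subspace theorem, no Ridout). -/
theorem thinFibreAt_rho1 (m₀ : ℕ) : ThinFibreAt m₀ (xPolyP 2 rho1) := thinFibreAt_of_levelFinite levelFinite_rho1 m₀

/-- `: ThinFibreAt 2 (xPolyP 2 rho1)`. -/
theorem thinFibreAt_two_rho1 : ThinFibreAt 2 (xPolyP 2 rho1) := thinFibreAt_rho1 2

/-! ## §6  ρ2 TRANSPORTED INTO THE x-LINEAR CLASS: `R₂(c) = (Y² − c·x)² − x·Y` ⟶ `c·Y⁴ + Y³ − x`, `Y⁴ + Y³ − c³·x` -/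

/-- **the descent core for `R₂(c)`**: an integer solution `W` of `(W² − c·p)² = p·2^{2h}·W` (`p > 0`, `c` an odd prime)
is PARAMETRISED by ONE integer `a`: `p = a³·(c·a + 2^h)` (the branch `gcd(W, p)`-cofactor `w = 1`) or
`c³·p = a³·(a + 2^h)` (the branch `w = c²`); the branch `w = c` is empty. -/
theorem core_bisq {c : ℤ} (hc : Prime c) (hodd : Odd c) {h : ℕ} {W p : ℤ} (hp0 : 0 < p)
    (hW : W ^ 4 - 2 * c * p * W ^ 2 - p * 2 ^ (2 * h) * W + c ^ 2 * p ^ 2 = 0) :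
    ∃ a : ℤ, p = a ^ 3 * (c * a + 2 ^ h) ∨ c ^ 3 * p = a ^ 3 * (a + 2 ^ h) := by
  have hsq : (W ^ 2 - c * p) ^ 2 = p * (2 ^ h) ^ 2 * W := by rw [← pow_mul, mul_comm h 2]; linear_combination hW
  have hW0 : W ≠ 0 := by
    rintro rfl
    have h0 : c ^ 2 * p ^ 2 = 0 := by linear_combination hW
    rcases mul_eq_zero.mp h0 with h0 | h0
    · exact hc.ne_zero (pow_eq_zero_iff two_ne_zero |>.mp h0)
    · exact hp0.ne' (pow_eq_zero_iff two_ne_zero |>.mp h0)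
  have hWpos : 0 < W := by
    rcases lt_or_gt_of_ne hW0 with hlt | hgt
    · exfalso
      have h1 : p * (2 ^ h) ^ 2 * W < 0 := mul_neg_of_pos_of_neg (by positivity) hlt
      nlinarith [sq_nonneg (W ^ 2 - c * p)]
    · exact hgt
  obtain ⟨g, w, q, hg, hwq, hWg, hpg⟩ := Int.exists_gcd_one' (Int.gcd_pos_of_ne_zero_left p hW0)
  have hg0 : (g : ℤ) ≠ 0 := by exact_mod_cast hg.ne'
  have hq0 : 0 < q := by
    rcases lt_trichotomy q 0 with hq | hq | hq
    · exfalso; rw [hpg] at hp0; nlinarith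
    · exfalso; rw [hpg, hq, zero_mul] at hp0; exact lt_irrefl _ hp0
    · exact hq
  have hw0 : 0 < w := by
    rcases lt_trichotomy w 0 with hw | hw | hw
    · exfalso; rw [hWg] at hWpos; nlinarith
    · exfalso; rw [hWg, hw, zero_mul] at hWpos; exact lt_irrefl _ hWpos
    · exact hw
  have hcop : IsCoprime w q := Int.isCoprime_iff_gcd_eq_one.mpr hwq
  -- (E2): (g·w² − c·q)² = q·w·(2^h)²
  have hE : ((g : ℤ) * w ^ 2 - c * q) ^ 2 = q * w * (2 ^ h) ^ 2 := by
    have h' : (g : ℤ) ^ 2 * (((g : ℤ) * w ^ 2 - c * q) ^ 2 - q * w * (2 ^ h) ^ 2) = 0 := by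
      rw [hWg, hpg] at hsq; linear_combination hsq
    rcases mul_eq_zero.mp h' with h0 | h0
    · exact absurd h0 (pow_ne_zero _ hg0)
    · linear_combination h0
  -- w ∣ c²
  have hwc : w ∣ c ^ 2 := by
    have h1 : w ∣ c ^ 2 * q ^ 2 :=
      ⟨q * (2 ^ h) ^ 2 - (g : ℤ) ^ 2 * w ^ 3 + 2 * c * (g : ℤ) * q * w, by linear_combination hE⟩
    exact (hcop.pow_right (n := 2)).dvd_of_dvd_mul_right h1
  have hc' : Nat.Prime c.natAbs := Int.prime_iff_natAbs_prime.mp hc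
  have hwc' : w.natAbs ∣ c.natAbs ^ 2 := by
    have := Int.natAbs_dvd_natAbs.mpr hwc
    rwa [Int.natAbs_pow] at this
  obtain ⟨i, hi, hwi⟩ := (Nat.dvd_prime_pow hc').1 hwc'
  have hwZ : w = (c.natAbs : ℤ) ^ i := by
    rw [← Int.natAbs_of_nonneg hw0.le, hwi]; push_cast; rfl
  interval_cases i
  · -- BRANCH w = 1: (g − c·q)² = q·(2^h)² ⟹ 2^h ∣ g − c·q, q = a², p = a³(c·a + 2^h)
    rw [pow_zero] at hwZ
    subst hwZ
    have hdvd : (2 : ℤ) ^ h ∣ (g : ℤ) - c * q :=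
      (Int.pow_dvd_pow_iff two_ne_zero).mp ⟨q, by linear_combination hE⟩
    obtain ⟨a, ha⟩ := hdvd
    have hqa : q = a ^ 2 := by
      have h0 : ((2 : ℤ) ^ h) ^ 2 * (a ^ 2 - q) = 0 := by
        have e : ((g : ℤ) * 1 ^ 2 - c * q) = 2 ^ h * a := by rw [← ha]; ring
        rw [e] at hE; linear_combination hE
      rcases mul_eq_zero.mp h0 with h0 | h0
      · exact absurd h0 (by positivity)
      · linear_combination -h0
    refine ⟨a, Or.inl ?_⟩
    have hg' : (g : ℤ) = c * q + 2 ^ h * a := by linear_combination ha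
    rw [hpg, hg', hqa]; ring
  · -- BRANCH w = |c|: c ∣ w, gcd(w, q) = 1 ⟹ c ⊥ q; then c ∣ q·v·(2^h)² forces c to be a unit — absurd
    exfalso
    rw [pow_one] at hwZ
    have hcw : c ∣ w := by rw [hwZ]; exact Int.dvd_natAbs.mpr dvd_rfl
    obtain ⟨v, hv⟩ := hcw
    have hv2 : v ^ 2 = 1 := by
      have h1 : w ^ 2 = c ^ 2 := by rw [hwZ, Int.natAbs_sq]
      rw [hv] at h1
      have h0 : c ^ 2 * (v ^ 2 - 1) = 0 := by linear_combination h1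
      rcases mul_eq_zero.mp h0 with h0 | h0
      · exact absurd h0 (pow_ne_zero _ hc.ne_zero)
      · linear_combination h0
    subst hv
    have hcq : IsCoprime c q := hcop.of_isCoprime_of_dvd_left (dvd_mul_right c v)
    have hcv : IsCoprime c v := ⟨0, v, by linear_combination hv2⟩
    have hc2 : IsCoprime c ((2 : ℤ) ^ h) := isCoprime_two_pow_of_odd hodd h
    have hcX : IsCoprime c (q * v * ((2 : ℤ) ^ h) ^ 2) := (hcq.mul_right hcv).mul_right (hc2.pow_right)
    -- c·(g·c·v² − q)² = q·v·(2^h)²  (cancel one c from (E2))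
    have hE' : c * ((g : ℤ) * c * v ^ 2 - q) ^ 2 = q * v * (2 ^ h) ^ 2 := by
      have h0 : c * (c * ((g : ℤ) * c * v ^ 2 - q) ^ 2 - q * v * (2 ^ h) ^ 2) = 0 := by linear_combination hE
      rcases mul_eq_zero.mp h0 with h0 | h0
      · exact absurd h0 hc.ne_zero
      · linear_combination h0
    have hdvd : c ∣ q * v * ((2 : ℤ) ^ h) ^ 2 := ⟨((g : ℤ) * c * v ^ 2 - q) ^ 2, by linear_combination -hE'⟩
    exact hc.not_unit (hcX.isUnit_of_dvd' dvd_rfl hdvd)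
  · -- BRANCH w = c²: (g·c³ − q)² = q·(2^h)² ⟹ q = a², c³·p = a³(a + 2^h)
    have hw2 : w = c ^ 2 := by rw [hwZ, Int.natAbs_sq]
    subst hw2
    have hE' : ((g : ℤ) * c ^ 3 - q) ^ 2 = q * (2 ^ h) ^ 2 := by
      have h0 : c ^ 2 * (((g : ℤ) * c ^ 3 - q) ^ 2 - q * (2 ^ h) ^ 2) = 0 := by linear_combination hE
      rcases mul_eq_zero.mp h0 with h0 | h0
      · exact absurd h0 (pow_ne_zero _ hc.ne_zero)
      · linear_combination h0
    have hdvd : (2 : ℤ) ^ h ∣ (g : ℤ) * c ^ 3 - q :=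
      (Int.pow_dvd_pow_iff two_ne_zero).mp ⟨q, by linear_combination hE'⟩
    obtain ⟨a, ha⟩ := hdvd
    have hqa : q = a ^ 2 := by
      have h0 : ((2 : ℤ) ^ h) ^ 2 * (a ^ 2 - q) = 0 := by
        rw [ha] at hE'; linear_combination hE'
      rcases mul_eq_zero.mp h0 with h0 | h0
      · exact absurd h0 (by positivity)
      · linear_combination -h0
    refine ⟨a, Or.inr ?_⟩
    have hg' : (g : ℤ) * c ^ 3 = q + 2 ^ h * a := by linear_combination ha
    calc c ^ 3 * p = q * ((g : ℤ) * c ^ 3) := by rw [hpg]; ring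
      _ = a ^ 3 * (a + 2 ^ h) := by rw [hg', hqa]; ring

/-- archimedean bookkeeping, branch `w = 1`: `p = a³(c·a + T)`, `0 < p < 2T⁴`, `|c| ≥ 3` ⟹ `|a| ≤ T`. -/
theorem bound_one {c a T p : ℤ} (hc3 : 3 ≤ |c|) (hT : 0 < T) (hp : p = a ^ 3 * (c * a + T)) (hp0 : 0 < p)
    (hplt : p < 2 * T ^ 4) : |a| ≤ T := by
  by_contra H
  push Not at H
  have h1 : |c| * |a| - T ≤ |c * a + T| := by
    have := abs_sub_abs_le_abs_sub (c * a) (-T)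
    rwa [abs_neg, abs_of_pos hT, sub_neg_eq_add, abs_mul] at this
  have h2 : 2 * |a| ≤ |c * a + T| := by nlinarith [abs_nonneg a]
  have h3 : |p| = |a| ^ 3 * |c * a + T| := by rw [hp, abs_mul, abs_pow]
  have h4 : 2 * |a| ^ 4 ≤ |p| := by
    rw [h3]; nlinarith [pow_nonneg (abs_nonneg a) 3]
  have h5 : T ^ 4 < |a| ^ 4 := pow_lt_pow_left₀ H hT.le (by norm_num)
  rw [abs_of_pos hp0] at h4
  linarith

end Summit.Schanuel.Schanuel.Theorems.RootDecomp1KResidueDescent
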